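import Literature.Topology.FourManifolds.SmoothEmbeddingCriteria
import Literature.Topology.FourManifolds.CellularSets
import HarnessLib

/-!
# Extension by the identity of a diffeomorphism along an open smooth embedding

Generic plumbing for cut-and-reglue arguments (used for Gompf's fishtail diffeomorphism,
R. Gompf, *More Cappell–Shaneson spheres are standard*, Algebr. Geom. Topol. 10 (2010),
Lemma 2.2: a diffeomorphism of the fishtail neighbourhood `Φ ⊆ X` which is the identity near the
frontier of its support extends by the identity to `X`). Let `ι : P → Y` be a smooth embedding
with open range between manifolds and `G` a diffeomorphism of `P` which is the identity at every
point mapped outside a closed set `K ⊆ range ι` of `Y`. Then `ι ∘ G ∘ ι⁻¹` on `range ι`, the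
identity elsewhere, is a diffeomorphism of `Y`
(`Literature.Topology.FourManifolds.exists_diffeomorph_extend`, built on the tree's
`extendAlong` of `CellularSets.lean`, which treats the topological case): near `range ι` it is a
composite of smooth maps (the inverse of an open smooth embedding is smooth on the range,
`contMDiffOn_leftInverse_of_isImmersion`), and near the open set `Y ∖ K` it is the identity.
This is Hirsch, *Differential Topology* (1976), Ch. 8 §1, Thm. 1.3 (extension of diffeotopies /
diffeomorphisms with support in an open subset), in the static flow-free form of the tree's
`chartTransportDiffeomorph` (`DiffeotopyTransport.lean`, there for charts onto a model vector
space), for an arbitrary open smooth embedding.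

Everything here is proved; no named facts.

## References

* M. W. Hirsch, *Differential Topology*, GTM 33 (1976), Ch. 8 §1, Thm. 1.3. [Hirsch1976]
* R. E. Gompf, *More Cappell–Shaneson spheres are standard*, Algebr. Geom. Topol. 10 (2010),
  Lemma 2.2 (proof). [GompfAGT2010]
-/

open scoped Manifold ContDiff Topology
open Set Function Filter

noncomputable section

namespace Literature.Topology.FourManifolds

section ExtendFun

variable {P Y : Type*} {ι : P → Y}

/-- **The extension `extendAlong ι F` (`CellularSets.lean`) is the identity on the complement of a
set `K ⊆ Y`** as soon as `F` fixes every point mapped outside `K`. [folklore] -/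
theorem extendAlong_eq_self_of_apply_not_mem (hinj : Injective ι) {F : P → P} {K : Set Y}
    (hfix : ∀ p, ι p ∉ K → F p = p) {y : Y} (hy : y ∉ K) : extendAlong ι F y = y := by
  by_cases hy' : y ∈ range ι
  · obtain ⟨p, rfl⟩ := hy'
    rw [extendAlong_apply_image hinj, hfix p hy]
  · exact extendAlong_apply_of_not_mem _ hy'

end ExtendFun

section Extend

variable {EP HP EY HY : Type*} [NormedAddCommGroup EP] [NormedSpace ℝ EP] [TopologicalSpace HP]
  [NormedAddCommGroup EY] [NormedSpace ℝ EY] [TopologicalSpace HY]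
  {IP : ModelWithCorners ℝ EP HP} {IY : ModelWithCorners ℝ EY HY}
  {P : Type*} [TopologicalSpace P] [ChartedSpace HP P]
  {Y : Type*} [TopologicalSpace Y] [ChartedSpace HY Y] {ι : P → Y}

/-- **Smoothness of the extension.** If `ι` is a smooth embedding with open range, `F` is smooth,
and `F` fixes every point mapped outside a closed `K ⊆ range ι`, the extension is smooth: on the
open set `range ι` it is `ι ∘ F ∘ ι⁻¹` with `ι⁻¹` smooth on the range
(`contMDiffOn_leftInverse_of_isImmersion`), on the open set `Y ∖ K` it is the identity. [cite: Hirsch1976, Ch. 8 §1, Thm. 1.3] -/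
theorem contMDiff_extendAlong_smooth (hι : Manifold.IsSmoothEmbedding IP IY ∞ ι) (hιo : IsOpen (range ι))
    {F : P → P} (hF : ContMDiff IP IP ∞ F) {K : Set Y} (hK : IsClosed K) (hKι : K ⊆ range ι)
    (hfix : ∀ p, ι p ∉ K → F p = p) : ContMDiff IY IY ∞ (extendAlong ι F) := by
  have hinj : Injective ι := hι.isEmbedding.injective
  intro y
  by_cases hy : y ∈ range ι
  · -- `P` is nonempty; the left inverse `g`
    haveI : Nonempty P := ⟨hy.choose⟩
    set g : Y → P := invFun ι with hg
    have hgl : LeftInverse g ι := leftInverse_invFun hinj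
    have hgs : ContMDiffOn IY IP ∞ g (range ι) :=
      contMDiffOn_leftInverse_of_isImmersion hι.isImmersion hι.isEmbedding hgl
    have heq : EqOn (extendAlong ι F) (ι ∘ F ∘ g) (range ι) := by
      rintro _ ⟨p, rfl⟩
      rw [extendAlong_apply_image hinj, comp_apply, comp_apply, hgl p]
    have h : ContMDiffOn IY IY ∞ (ι ∘ F ∘ g) (range ι) :=
      hι.contMDiff.comp_contMDiffOn (hF.comp_contMDiffOn hgs)
    exact (h.congr heq).contMDiffAt (hιo.mem_nhds hy)
  · have hyK : y ∉ K := fun h ↦ hy (hKι h)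
    have hev : extendAlong ι F =ᶠ[𝓝 y] id := by
      filter_upwards [hK.isOpen_compl.mem_nhds hyK] with y' hy'
      exact extendAlong_eq_self_of_apply_not_mem hinj hfix hy'
    exact contMDiffAt_id.congr_of_eventuallyEq hev

/-- **Extension by the identity of a diffeomorphism along an open smooth embedding.** For a
smooth embedding `ι : P → Y` with open range, a diffeomorphism `G` of `P` which is the identity at
every point mapped outside a closed `K ⊆ range ι`, the map `ι ∘ G ∘ ι⁻¹` on `range ι` extended by
the identity is a diffeomorphism of `Y`. Hirsch (1976), Ch. 8 §1, Thm. 1.3. [cite: Hirsch1976, Ch. 8 §1, Thm. 1.3] -/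
def extendDiffeomorph (hι : Manifold.IsSmoothEmbedding IP IY ∞ ι) (hιo : IsOpen (range ι))
    (G : P ≃ₘ⟮IP, IP⟯ P) {K : Set Y} (hK : IsClosed K) (hKι : K ⊆ range ι)
    (hfix : ∀ p, ι p ∉ K → G p = p) : Y ≃ₘ⟮IY, IY⟯ Y where
  toFun := extendAlong ι G
  invFun := extendAlong ι G.symm
  left_inv y := by
    rw [extendAlong_extendAlong hι.isEmbedding.injective,
      show (⇑G.symm ∘ ⇑G) = id from funext G.symm_apply_apply,
      extendAlong_id_apply hι.isEmbedding.injective]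
  right_inv y := by
    rw [extendAlong_extendAlong hι.isEmbedding.injective,
      show (⇑G ∘ ⇑G.symm) = id from funext G.apply_symm_apply,
      extendAlong_id_apply hι.isEmbedding.injective]
  contMDiff_toFun := contMDiff_extendAlong_smooth hι hιo G.contMDiff hK hKι hfix
  contMDiff_invFun := contMDiff_extendAlong_smooth hι hιo G.symm.contMDiff hK hKι fun p hp ↦ by
    conv_lhs => rw [← hfix p hp]
    exact G.symm_apply_apply p

/-- **The extension on the range**: `Ĝ (ι p) = ι (G p)`. [folklore] -/
@[simp] theorem extendDiffeomorph_apply (hι : Manifold.IsSmoothEmbedding IP IY ∞ ι)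
    (hιo : IsOpen (range ι)) (G : P ≃ₘ⟮IP, IP⟯ P) {K : Set Y} (hK : IsClosed K) (hKι : K ⊆ range ι)
    (hfix : ∀ p, ι p ∉ K → G p = p) (p : P) :
    extendDiffeomorph hι hιo G hK hKι hfix (ι p) = ι (G p) :=
  extendAlong_apply_image hι.isEmbedding.injective _ p

/-- **The extension off the range** is the identity. [folklore] -/
theorem extendDiffeomorph_of_not_mem (hι : Manifold.IsSmoothEmbedding IP IY ∞ ι)
    (hιo : IsOpen (range ι)) (G : P ≃ₘ⟮IP, IP⟯ P) {K : Set Y} (hK : IsClosed K) (hKι : K ⊆ range ι)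
    (hfix : ∀ p, ι p ∉ K → G p = p) {y : Y} (hy : y ∉ range ι) :
    extendDiffeomorph hι hιo G hK hKι hfix y = y :=
  extendAlong_apply_of_not_mem _ hy

/-- The extension off `K` is the identity. [folklore] -/
theorem extendDiffeomorph_of_not_mem_K (hι : Manifold.IsSmoothEmbedding IP IY ∞ ι)
    (hιo : IsOpen (range ι)) (G : P ≃ₘ⟮IP, IP⟯ P) {K : Set Y} (hK : IsClosed K) (hKι : K ⊆ range ι)
    (hfix : ∀ p, ι p ∉ K → G p = p) {y : Y} (hy : y ∉ K) :
    extendDiffeomorph hι hιo G hK hKι hfix y = y :=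
  extendAlong_eq_self_of_apply_not_mem hι.isEmbedding.injective hfix hy

/-- Existence form. [cite: Hirsch1976, Ch. 8 §1, Thm. 1.3] -/
theorem exists_diffeomorph_extend (hι : Manifold.IsSmoothEmbedding IP IY ∞ ι)
    (hιo : IsOpen (range ι)) (G : P ≃ₘ⟮IP, IP⟯ P) {K : Set Y} (hK : IsClosed K) (hKι : K ⊆ range ι)
    (hfix : ∀ p, ι p ∉ K → G p = p) :
    ∃ GY : Y ≃ₘ⟮IY, IY⟯ Y, (∀ p, GY (ι p) = ι (G p)) ∧ ∀ y, y ∉ range ι → GY y = y :=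
  ⟨extendDiffeomorph hι hιo G hK hKι hfix, extendDiffeomorph_apply hι hιo G hK hKι hfix,
    fun _ hy ↦ extendDiffeomorph_of_not_mem hι hιo G hK hKι hfix hy⟩

end Extend

end Literature.Topology.FourManifolds
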